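import Literature.Probability.Distributions.BrascampLiebCube
import Literature.Probability.Distributions.BrascampLiebOneDim
import HarnessLib

/-!
# The Brascamp–Lieb variance inequality on cubes, by induction on the dimension

`Literature/Probability/Distributions/`. The core of the proof of Brascamp–Lieb's Theorem 4.1
(`BrascampLieb1976_thm41`, file `BrascampLieb`): for `S > 0`, `f ∈ C²(ℝⁿ)` with positive definite
coordinate Hessian everywhere and `h ∈ C¹(ℝⁿ)`, the RAW (unnormalised) inequality on the cube
`K = [-S,S]ⁿ`

  `(∫_K h² e^{-f})(∫_K e^{-f}) − (∫_K h e^{-f})² ≤ (∫_K ∇hᵀ f_xx⁻¹ ∇h · e^{-f})(∫_K e^{-f})`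

(`bl_cube`), i.e. `Var_{μ_K} h ≤ E_{μ_K}[∇hᵀ f_xx⁻¹ ∇h]` for `μ_K ∝ e^{-f} 1_K` — Brascamp–Lieb's
eq. (4.11) with balls replaced by cubes. Architecture (the paper's induction, pp. 377–378,
re-organised so that every fibre integral is over a compact cube):

* `n = 0`: both sides vanish (`bl_cube_zero`).
* step `m → m+1` (`bl_cube_succ`): split `x = (y, z)`; with the fibre integrals
  `Z, A, B, P, R, C, T, U, Q` of `1, h, h², ∂₀h, ∂₀f, h∂₀f, (∂₀f)², f₀₀, ∇hᵀf_xx⁻¹∇h` against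
  `e^{-f(y,·)}` over `[-S,S]^m`, the marginal `g = −log Z` has `g' = R/Z`,
  `g'' = ((U−T)Z + R²)/Z² > 0` (`step_Ng_pos`: inductive hypothesis for `∂₀f(y,·)` plus Schur
  positivity), `H = A/Z` has `H' = ((P−C)Z + AR)/Z²` (differentiation under the integral sign);
  the pointwise variational bound (`blQuad_fibre_bound`) integrated (`step_integrated_bound`) and
  the inductive hypothesis for `φ_t = h − t∂₀f` with the optimal `t = H'/g''` give the fibre
  inequality `Var_z h + H'²/g'' ≤ ⟨∇hᵀf_xx⁻¹∇h⟩_z` (`step_main_fibre`, the content of the paper's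
  (4.9)–(4.10)); integrating in `y` and applying the one-dimensional interval inequality
  (`brascampLieb_interval_Icc`) to `(g, H)` on `[-S,S]` closes the step via
  `Var h = ⟨Var_z h⟩_y + Var_y H`.

Statements are written out in full (cube `Set.pi univ fun _ => Icc (-S) S`, integrand
`coordGradient h x ⬝ᵥ ((coordHessian f x)⁻¹ *ᵥ coordGradient h x)`); no definitions, no notation.
-/

noncomputable section

open Matrix MeasureTheory Set Filter Function
open scoped Topology

namespace Literature.Probability.Distributions

variable {m : ℕ}

/-- The integrated fibre bound: integrating `blQuad_fibre_bound` against `e^{-f}` over the fibre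
cube gives `2t ∫∂₀h e^{-f} − t² ∫f₀₀ e^{-f} + ∫ (∇_zφ_t)ᵀ f_zz⁻¹ ∇_zφ_t e^{-f} ≤ ∫ ∇hᵀf_xx⁻¹∇h e^{-f}`.
[cite: BrascampLieb1976, proof of Thm 4.1] -/
theorem step_integrated_bound {f h : (Fin (m + 1) → ℝ) → ℝ} (hf : ContDiff ℝ 2 f)
    (hpd : ∀ x, (coordHessian f x).PosDef) (hh : ContDiff ℝ 1 h) (S y t : ℝ) :
    2 * t * (∫ z in (Set.pi (Set.univ : Set (Fin m)) fun _ => Set.Icc (-S) S), fderiv ℝ h (Fin.cons y z) (Pi.single 0 1) *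
        Real.exp (-f (Fin.cons y z))) -
      t ^ 2 * (∫ z in (Set.pi (Set.univ : Set (Fin m)) fun _ => Set.Icc (-S) S), coordHessian f (Fin.cons y z) 0 0 * Real.exp (-f (Fin.cons y z))) +
      (∫ z in (Set.pi (Set.univ : Set (Fin m)) fun _ => Set.Icc (-S) S), (coordGradient (fun z : Fin m → ℝ => h (Fin.cons y z) - t * fderiv ℝ f (Fin.cons y z) (Pi.single 0 1)) z ⬝ᵥ ((coordHessian (fun z : Fin m → ℝ => f (Fin.cons y z)) z)⁻¹ *ᵥ coordGradient (fun z : Fin m → ℝ => h (Fin.cons y z) - t * fderiv ℝ f (Fin.cons y z) (Pi.single 0 1)) z)) * Real.exp (-f (Fin.cons y z))) ≤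
    ∫ z in (Set.pi (Set.univ : Set (Fin m)) fun _ => Set.Icc (-S) S), (coordGradient h (Fin.cons y z) ⬝ᵥ ((coordHessian f (Fin.cons y z))⁻¹ *ᵥ coordGradient h (Fin.cons y z))) * Real.exp (-f (Fin.cons y z)) := by
  have hEc : Continuous fun x => Real.exp (-f x) := continuous_expNeg hf.continuous
  have hf0 : ContDiff ℝ 1 (fun x => fderiv ℝ f x (Pi.single 0 1)) :=
    contDiff_one_fderiv_apply hf _
  have hh0c : Continuous fun x => fderiv ℝ h x (Pi.single 0 1) := continuous_fderiv_apply hh _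
  have hf00c : Continuous fun x => coordHessian f x 0 0 :=
    (continuous_coordHessian hf).matrix_elem 0 0
  have hqc : Continuous fun x => (coordGradient h x ⬝ᵥ ((coordHessian f x)⁻¹ *ᵥ coordGradient h x)) := continuous_blQuad hf hpd hh
  -- the fibre data
  have hfy : ContDiff ℝ 2 (fun z : Fin m → ℝ => f (Fin.cons y z)) := hf.comp (contDiff_cons_right y)
  have hpdy : ∀ z, (coordHessian (fun z : Fin m → ℝ => f (Fin.cons y z)) z).PosDef :=
    posDef_coordHessian_comp_cons hf hpd y
  have hφ : ContDiff ℝ 1 (fun z : Fin m → ℝ => h (Fin.cons y z) -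
      t * fderiv ℝ f (Fin.cons y z) (Pi.single 0 1)) :=
    (hh.comp (contDiff_cons_right y)).sub (contDiff_const.mul (hf0.comp (contDiff_cons_right y)))
  have hqtc : Continuous fun z : Fin m → ℝ => (coordGradient (fun z : Fin m → ℝ => h (Fin.cons y z) - t * fderiv ℝ f (Fin.cons y z) (Pi.single 0 1)) z ⬝ᵥ ((coordHessian (fun z : Fin m → ℝ => f (Fin.cons y z)) z)⁻¹ *ᵥ coordGradient (fun z : Fin m → ℝ => h (Fin.cons y z) - t * fderiv ℝ f (Fin.cons y z) (Pi.single 0 1)) z)) :=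
    continuous_blQuad hfy hpdy hφ
  have hEyc : Continuous fun z : Fin m → ℝ => Real.exp (-f (Fin.cons y z)) :=
    hEc.comp (continuous_cons_right y)
  -- integrability on the fibre cube
  have i1 : IntegrableOn (fun z : Fin m → ℝ => fderiv ℝ h (Fin.cons y z) (Pi.single 0 1) *
      Real.exp (-f (Fin.cons y z))) ((Set.pi (Set.univ : Set (Fin m)) fun _ => Set.Icc (-S) S)) volume :=
    integrableOn_fibre (ψ := fun x => fderiv ℝ h x (Pi.single 0 1) * Real.exp (-f x))
      (hh0c.mul hEc) S y
  have i2 : IntegrableOn (fun z : Fin m → ℝ => coordHessian f (Fin.cons y z) 0 0 *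
      Real.exp (-f (Fin.cons y z))) ((Set.pi (Set.univ : Set (Fin m)) fun _ => Set.Icc (-S) S)) volume :=
    integrableOn_fibre (ψ := fun x => coordHessian f x 0 0 * Real.exp (-f x)) (hf00c.mul hEc) S y
  have i3 : IntegrableOn (fun z : Fin m → ℝ => (coordGradient (fun z : Fin m → ℝ => h (Fin.cons y z) - t * fderiv ℝ f (Fin.cons y z) (Pi.single 0 1)) z ⬝ᵥ ((coordHessian (fun z : Fin m → ℝ => f (Fin.cons y z)) z)⁻¹ *ᵥ coordGradient (fun z : Fin m → ℝ => h (Fin.cons y z) - t * fderiv ℝ f (Fin.cons y z) (Pi.single 0 1)) z)) *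
      Real.exp (-f (Fin.cons y z))) ((Set.pi (Set.univ : Set (Fin m)) fun _ => Set.Icc (-S) S)) volume :=
    integrableOn_cube (hqtc.mul hEyc) S
  have i4 : IntegrableOn (fun z : Fin m → ℝ => (coordGradient h (Fin.cons y z) ⬝ᵥ ((coordHessian f (Fin.cons y z))⁻¹ *ᵥ coordGradient h (Fin.cons y z))) * Real.exp (-f (Fin.cons y z)))
      ((Set.pi (Set.univ : Set (Fin m)) fun _ => Set.Icc (-S) S)) volume :=
    integrableOn_fibre (ψ := fun x => (coordGradient h x ⬝ᵥ ((coordHessian f x)⁻¹ *ᵥ coordGradient h x)) * Real.exp (-f x)) (hqc.mul hEc) S y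
  -- pointwise bound times the weight
  have hpt : ∀ z : Fin m → ℝ,
      2 * t * (fderiv ℝ h (Fin.cons y z) (Pi.single 0 1) * Real.exp (-f (Fin.cons y z))) -
        t ^ 2 * (coordHessian f (Fin.cons y z) 0 0 * Real.exp (-f (Fin.cons y z))) +
        (coordGradient (fun z : Fin m → ℝ => h (Fin.cons y z) - t * fderiv ℝ f (Fin.cons y z) (Pi.single 0 1)) z ⬝ᵥ ((coordHessian (fun z : Fin m → ℝ => f (Fin.cons y z)) z)⁻¹ *ᵥ coordGradient (fun z : Fin m → ℝ => h (Fin.cons y z) - t * fderiv ℝ f (Fin.cons y z) (Pi.single 0 1)) z)) * Real.exp (-f (Fin.cons y z)) ≤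
      (coordGradient h (Fin.cons y z) ⬝ᵥ ((coordHessian f (Fin.cons y z))⁻¹ *ᵥ coordGradient h (Fin.cons y z))) * Real.exp (-f (Fin.cons y z)) := by
    intro z
    have hb := blQuad_fibre_bound hf hpd hh y z t
    have hE : 0 ≤ Real.exp (-f (Fin.cons y z)) := (Real.exp_pos _).le
    have := mul_le_mul_of_nonneg_right hb hE
    have e : (2 * t * coordGradient h (Fin.cons y z) 0 - t ^ 2 * coordHessian f (Fin.cons y z) 0 0 +
        (coordGradient (fun z : Fin m → ℝ => h (Fin.cons y z) - t * fderiv ℝ f (Fin.cons y z) (Pi.single 0 1)) z ⬝ᵥ ((coordHessian (fun z : Fin m → ℝ => f (Fin.cons y z)) z)⁻¹ *ᵥ coordGradient (fun z : Fin m → ℝ => h (Fin.cons y z) - t * fderiv ℝ f (Fin.cons y z) (Pi.single 0 1)) z))) * Real.exp (-f (Fin.cons y z)) =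
      2 * t * (fderiv ℝ h (Fin.cons y z) (Pi.single 0 1) * Real.exp (-f (Fin.cons y z))) -
        t ^ 2 * (coordHessian f (Fin.cons y z) 0 0 * Real.exp (-f (Fin.cons y z))) +
        (coordGradient (fun z : Fin m → ℝ => h (Fin.cons y z) - t * fderiv ℝ f (Fin.cons y z) (Pi.single 0 1)) z ⬝ᵥ ((coordHessian (fun z : Fin m → ℝ => f (Fin.cons y z)) z)⁻¹ *ᵥ coordGradient (fun z : Fin m → ℝ => h (Fin.cons y z) - t * fderiv ℝ f (Fin.cons y z) (Pi.single 0 1)) z)) * Real.exp (-f (Fin.cons y z)) := by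
      simp only [coordGradient]; ring
    rw [e] at this
    exact this
  have i1' : IntegrableOn (fun z : Fin m → ℝ => 2 * t * (fderiv ℝ h (Fin.cons y z) (Pi.single 0 1) *
      Real.exp (-f (Fin.cons y z)))) ((Set.pi (Set.univ : Set (Fin m)) fun _ => Set.Icc (-S) S)) volume := i1.const_mul _
  have i2' : IntegrableOn (fun z : Fin m → ℝ => t ^ 2 * (coordHessian f (Fin.cons y z) 0 0 *
      Real.exp (-f (Fin.cons y z)))) ((Set.pi (Set.univ : Set (Fin m)) fun _ => Set.Icc (-S) S)) volume := i2.const_mul _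
  have i12 : IntegrableOn (fun z : Fin m → ℝ =>
      2 * t * (fderiv ℝ h (Fin.cons y z) (Pi.single 0 1) * Real.exp (-f (Fin.cons y z))) -
        t ^ 2 * (coordHessian f (Fin.cons y z) 0 0 * Real.exp (-f (Fin.cons y z))))
      ((Set.pi (Set.univ : Set (Fin m)) fun _ => Set.Icc (-S) S)) volume := i1'.sub i2'
  have iL : IntegrableOn (fun z : Fin m → ℝ =>
      2 * t * (fderiv ℝ h (Fin.cons y z) (Pi.single 0 1) * Real.exp (-f (Fin.cons y z))) -
        t ^ 2 * (coordHessian f (Fin.cons y z) 0 0 * Real.exp (-f (Fin.cons y z))) +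
        (coordGradient (fun z : Fin m → ℝ => h (Fin.cons y z) - t * fderiv ℝ f (Fin.cons y z) (Pi.single 0 1)) z ⬝ᵥ ((coordHessian (fun z : Fin m → ℝ => f (Fin.cons y z)) z)⁻¹ *ᵥ coordGradient (fun z : Fin m → ℝ => h (Fin.cons y z) - t * fderiv ℝ f (Fin.cons y z) (Pi.single 0 1)) z)) * Real.exp (-f (Fin.cons y z))) ((Set.pi (Set.univ : Set (Fin m)) fun _ => Set.Icc (-S) S)) volume := i12.add i3
  have hmono : (∫ z in (Set.pi (Set.univ : Set (Fin m)) fun _ => Set.Icc (-S) S),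
      (2 * t * (fderiv ℝ h (Fin.cons y z) (Pi.single 0 1) * Real.exp (-f (Fin.cons y z))) -
        t ^ 2 * (coordHessian f (Fin.cons y z) 0 0 * Real.exp (-f (Fin.cons y z))) +
        (coordGradient (fun z : Fin m → ℝ => h (Fin.cons y z) - t * fderiv ℝ f (Fin.cons y z) (Pi.single 0 1)) z ⬝ᵥ ((coordHessian (fun z : Fin m → ℝ => f (Fin.cons y z)) z)⁻¹ *ᵥ coordGradient (fun z : Fin m → ℝ => h (Fin.cons y z) - t * fderiv ℝ f (Fin.cons y z) (Pi.single 0 1)) z)) * Real.exp (-f (Fin.cons y z)))) ≤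
      ∫ z in (Set.pi (Set.univ : Set (Fin m)) fun _ => Set.Icc (-S) S), (coordGradient h (Fin.cons y z) ⬝ᵥ ((coordHessian f (Fin.cons y z))⁻¹ *ᵥ coordGradient h (Fin.cons y z))) * Real.exp (-f (Fin.cons y z)) :=
    setIntegral_mono iL i4 hpt
  rw [integral_add i12 i3, integral_sub i1' i2', integral_const_mul, integral_const_mul] at hmono
  exact hmono

/-- The Schur scalar integrated over a fibre is positive:
`∫ (∇_z∂₀f)ᵀ f_zz⁻¹ (∇_z∂₀f) e^{-f} < ∫ f₀₀ e^{-f}` (`S > 0`). [folklore] -/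
theorem step_W_lt_U {f : (Fin (m + 1) → ℝ) → ℝ} (hf : ContDiff ℝ 2 f)
    (hpd : ∀ x, (coordHessian f x).PosDef) {S : ℝ} (hS : 0 < S) (y : ℝ) :
    (∫ z in (Set.pi (Set.univ : Set (Fin m)) fun _ => Set.Icc (-S) S), (coordGradient (fun z : Fin m → ℝ => fderiv ℝ f (Fin.cons y z) (Pi.single 0 1)) z ⬝ᵥ ((coordHessian (fun z : Fin m → ℝ => f (Fin.cons y z)) z)⁻¹ *ᵥ coordGradient (fun z : Fin m → ℝ => fderiv ℝ f (Fin.cons y z) (Pi.single 0 1)) z)) *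
        Real.exp (-f (Fin.cons y z))) <
      ∫ z in (Set.pi (Set.univ : Set (Fin m)) fun _ => Set.Icc (-S) S), coordHessian f (Fin.cons y z) 0 0 * Real.exp (-f (Fin.cons y z)) := by
  have hEc : Continuous fun x => Real.exp (-f x) := continuous_expNeg hf.continuous
  have hf0 : ContDiff ℝ 1 (fun x => fderiv ℝ f x (Pi.single 0 1)) :=
    contDiff_one_fderiv_apply hf _
  have hf00c : Continuous fun x => coordHessian f x 0 0 :=
    (continuous_coordHessian hf).matrix_elem 0 0
  have hfy : ContDiff ℝ 2 (fun z : Fin m → ℝ => f (Fin.cons y z)) := hf.comp (contDiff_cons_right y)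
  have hpdy : ∀ z, (coordHessian (fun z : Fin m → ℝ => f (Fin.cons y z)) z).PosDef :=
    posDef_coordHessian_comp_cons hf hpd y
  have hφ : ContDiff ℝ 1 (fun z : Fin m → ℝ => fderiv ℝ f (Fin.cons y z) (Pi.single 0 1)) :=
    hf0.comp (contDiff_cons_right y)
  have hwc : Continuous fun z : Fin m → ℝ => (coordGradient (fun z : Fin m → ℝ => fderiv ℝ f (Fin.cons y z) (Pi.single 0 1)) z ⬝ᵥ ((coordHessian (fun z : Fin m → ℝ => f (Fin.cons y z)) z)⁻¹ *ᵥ coordGradient (fun z : Fin m → ℝ => fderiv ℝ f (Fin.cons y z) (Pi.single 0 1)) z)) :=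
    continuous_blQuad hfy hpdy hφ
  have hEyc : Continuous fun z : Fin m → ℝ => Real.exp (-f (Fin.cons y z)) :=
    hEc.comp (continuous_cons_right y)
  have i1 : IntegrableOn (fun z : Fin m → ℝ => (coordGradient (fun z : Fin m → ℝ => fderiv ℝ f (Fin.cons y z) (Pi.single 0 1)) z ⬝ᵥ ((coordHessian (fun z : Fin m → ℝ => f (Fin.cons y z)) z)⁻¹ *ᵥ coordGradient (fun z : Fin m → ℝ => fderiv ℝ f (Fin.cons y z) (Pi.single 0 1)) z)) *
      Real.exp (-f (Fin.cons y z))) ((Set.pi (Set.univ : Set (Fin m)) fun _ => Set.Icc (-S) S)) volume :=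
    integrableOn_cube (hwc.mul hEyc) S
  have i2 : IntegrableOn (fun z : Fin m → ℝ => coordHessian f (Fin.cons y z) 0 0 *
      Real.exp (-f (Fin.cons y z))) ((Set.pi (Set.univ : Set (Fin m)) fun _ => Set.Icc (-S) S)) volume :=
    integrableOn_fibre (ψ := fun x => coordHessian f x 0 0 * Real.exp (-f x)) (hf00c.mul hEc) S y
  have hpos := setIntegral_cube_pos (m := m)
    (ψ := fun z : Fin m → ℝ => (coordHessian f (Fin.cons y z) 0 0 -
      (coordGradient (fun z : Fin m → ℝ => fderiv ℝ f (Fin.cons y z) (Pi.single 0 1)) z ⬝ᵥ ((coordHessian (fun z : Fin m → ℝ => f (Fin.cons y z)) z)⁻¹ *ᵥ coordGradient (fun z : Fin m → ℝ => fderiv ℝ f (Fin.cons y z) (Pi.single 0 1)) z))) *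
      Real.exp (-f (Fin.cons y z)))
    (((hf00c.comp (continuous_cons_right y)).sub hwc).mul hEyc)
    (fun z => mul_pos (schur_fibre_pos hf hpd y z) (Real.exp_pos _)) hS
  have e : ∫ z in (Set.pi (Set.univ : Set (Fin m)) fun _ => Set.Icc (-S) S), (coordHessian f (Fin.cons y z) 0 0 -
      (coordGradient (fun z : Fin m → ℝ => fderiv ℝ f (Fin.cons y z) (Pi.single 0 1)) z ⬝ᵥ ((coordHessian (fun z : Fin m → ℝ => f (Fin.cons y z)) z)⁻¹ *ᵥ coordGradient (fun z : Fin m → ℝ => fderiv ℝ f (Fin.cons y z) (Pi.single 0 1)) z))) *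
      Real.exp (-f (Fin.cons y z)) =
      (∫ z in (Set.pi (Set.univ : Set (Fin m)) fun _ => Set.Icc (-S) S), coordHessian f (Fin.cons y z) 0 0 * Real.exp (-f (Fin.cons y z))) -
      ∫ z in (Set.pi (Set.univ : Set (Fin m)) fun _ => Set.Icc (-S) S), (coordGradient (fun z : Fin m → ℝ => fderiv ℝ f (Fin.cons y z) (Pi.single 0 1)) z ⬝ᵥ ((coordHessian (fun z : Fin m → ℝ => f (Fin.cons y z)) z)⁻¹ *ᵥ coordGradient (fun z : Fin m → ℝ => fderiv ℝ f (Fin.cons y z) (Pi.single 0 1)) z)) *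
        Real.exp (-f (Fin.cons y z)) := by
    rw [← integral_sub i2 i1]
    refine integral_congr_ae (Eventually.of_forall fun z => ?_)
    ring
  rw [e] at hpos
  linarith

/-- Expansion of the fibre moments of `φ_t = h(y,·) − t ∂₀f(y,·)`:
`∫ φ_t² e^{-f} = B − 2tC + t²T` and `∫ φ_t e^{-f} = A − tR`. [folklore] -/
theorem step_expand {f h : (Fin (m + 1) → ℝ) → ℝ} (hf : ContDiff ℝ 2 f) (hh : ContDiff ℝ 1 h)
    (S y t : ℝ) :
    (∫ z in (Set.pi (Set.univ : Set (Fin m)) fun _ => Set.Icc (-S) S), (h (Fin.cons y z) - t * fderiv ℝ f (Fin.cons y z) (Pi.single 0 1)) ^ 2 *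
        Real.exp (-f (Fin.cons y z))) =
      (∫ z in (Set.pi (Set.univ : Set (Fin m)) fun _ => Set.Icc (-S) S), h (Fin.cons y z) ^ 2 * Real.exp (-f (Fin.cons y z))) -
        2 * t * (∫ z in (Set.pi (Set.univ : Set (Fin m)) fun _ => Set.Icc (-S) S), h (Fin.cons y z) * fderiv ℝ f (Fin.cons y z) (Pi.single 0 1) *
          Real.exp (-f (Fin.cons y z))) +
        t ^ 2 * (∫ z in (Set.pi (Set.univ : Set (Fin m)) fun _ => Set.Icc (-S) S), (fderiv ℝ f (Fin.cons y z) (Pi.single 0 1)) ^ 2 *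
          Real.exp (-f (Fin.cons y z))) ∧
    (∫ z in (Set.pi (Set.univ : Set (Fin m)) fun _ => Set.Icc (-S) S), (h (Fin.cons y z) - t * fderiv ℝ f (Fin.cons y z) (Pi.single 0 1)) *
        Real.exp (-f (Fin.cons y z))) =
      (∫ z in (Set.pi (Set.univ : Set (Fin m)) fun _ => Set.Icc (-S) S), h (Fin.cons y z) * Real.exp (-f (Fin.cons y z))) -
        t * (∫ z in (Set.pi (Set.univ : Set (Fin m)) fun _ => Set.Icc (-S) S), fderiv ℝ f (Fin.cons y z) (Pi.single 0 1) *
          Real.exp (-f (Fin.cons y z))) := by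
  have hEc : Continuous fun x => Real.exp (-f x) := continuous_expNeg hf.continuous
  have hhc : Continuous h := hh.continuous
  have hf0c : Continuous fun x => fderiv ℝ f x (Pi.single 0 1) :=
    continuous_fderiv_apply (hf.of_le one_le_two) _
  have iB : IntegrableOn (fun z : Fin m → ℝ => h (Fin.cons y z) ^ 2 * Real.exp (-f (Fin.cons y z)))
      ((Set.pi (Set.univ : Set (Fin m)) fun _ => Set.Icc (-S) S)) volume :=
    integrableOn_fibre (ψ := fun x => h x ^ 2 * Real.exp (-f x)) ((hhc.pow 2).mul hEc) S y
  have iC : IntegrableOn (fun z : Fin m → ℝ => h (Fin.cons y z) *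
      fderiv ℝ f (Fin.cons y z) (Pi.single 0 1) * Real.exp (-f (Fin.cons y z))) ((Set.pi (Set.univ : Set (Fin m)) fun _ => Set.Icc (-S) S)) volume :=
    integrableOn_fibre (ψ := fun x => h x * fderiv ℝ f x (Pi.single 0 1) * Real.exp (-f x))
      ((hhc.mul hf0c).mul hEc) S y
  have iT : IntegrableOn (fun z : Fin m → ℝ => (fderiv ℝ f (Fin.cons y z) (Pi.single 0 1)) ^ 2 *
      Real.exp (-f (Fin.cons y z))) ((Set.pi (Set.univ : Set (Fin m)) fun _ => Set.Icc (-S) S)) volume :=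
    integrableOn_fibre (ψ := fun x => (fderiv ℝ f x (Pi.single 0 1)) ^ 2 * Real.exp (-f x))
      ((hf0c.pow 2).mul hEc) S y
  have iA : IntegrableOn (fun z : Fin m → ℝ => h (Fin.cons y z) * Real.exp (-f (Fin.cons y z)))
      ((Set.pi (Set.univ : Set (Fin m)) fun _ => Set.Icc (-S) S)) volume :=
    integrableOn_fibre (ψ := fun x => h x * Real.exp (-f x)) (hhc.mul hEc) S y
  have iR : IntegrableOn (fun z : Fin m → ℝ => fderiv ℝ f (Fin.cons y z) (Pi.single 0 1) *
      Real.exp (-f (Fin.cons y z))) ((Set.pi (Set.univ : Set (Fin m)) fun _ => Set.Icc (-S) S)) volume :=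
    integrableOn_fibre (ψ := fun x => fderiv ℝ f x (Pi.single 0 1) * Real.exp (-f x))
      (hf0c.mul hEc) S y
  constructor
  · have e : (fun z : Fin m → ℝ => (h (Fin.cons y z) - t * fderiv ℝ f (Fin.cons y z) (Pi.single 0 1)) ^ 2 *
        Real.exp (-f (Fin.cons y z))) = fun z =>
        (h (Fin.cons y z) ^ 2 * Real.exp (-f (Fin.cons y z)) -
          2 * t * (h (Fin.cons y z) * fderiv ℝ f (Fin.cons y z) (Pi.single 0 1) *
            Real.exp (-f (Fin.cons y z)))) +
        t ^ 2 * ((fderiv ℝ f (Fin.cons y z) (Pi.single 0 1)) ^ 2 * Real.exp (-f (Fin.cons y z))) := by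
      funext z; ring
    have iC' : IntegrableOn (fun z : Fin m → ℝ => 2 * t * (h (Fin.cons y z) *
        fderiv ℝ f (Fin.cons y z) (Pi.single 0 1) * Real.exp (-f (Fin.cons y z)))) ((Set.pi (Set.univ : Set (Fin m)) fun _ => Set.Icc (-S) S)) volume :=
      iC.const_mul _
    have iT' : IntegrableOn (fun z : Fin m → ℝ => t ^ 2 * ((fderiv ℝ f (Fin.cons y z) (Pi.single 0 1)) ^ 2 *
        Real.exp (-f (Fin.cons y z)))) ((Set.pi (Set.univ : Set (Fin m)) fun _ => Set.Icc (-S) S)) volume := iT.const_mul _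
    have iBC : IntegrableOn (fun z : Fin m → ℝ => h (Fin.cons y z) ^ 2 * Real.exp (-f (Fin.cons y z)) -
        2 * t * (h (Fin.cons y z) * fderiv ℝ f (Fin.cons y z) (Pi.single 0 1) *
          Real.exp (-f (Fin.cons y z)))) ((Set.pi (Set.univ : Set (Fin m)) fun _ => Set.Icc (-S) S)) volume := iB.sub iC'
    rw [e, integral_add iBC iT', integral_sub iB iC', integral_const_mul, integral_const_mul]
  · have e : (fun z : Fin m → ℝ => (h (Fin.cons y z) - t * fderiv ℝ f (Fin.cons y z) (Pi.single 0 1)) *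
        Real.exp (-f (Fin.cons y z))) = fun z =>
        h (Fin.cons y z) * Real.exp (-f (Fin.cons y z)) -
          t * (fderiv ℝ f (Fin.cons y z) (Pi.single 0 1) * Real.exp (-f (Fin.cons y z))) := by
      funext z; ring
    have iR' : IntegrableOn (fun z : Fin m → ℝ => t * (fderiv ℝ f (Fin.cons y z) (Pi.single 0 1) *
        Real.exp (-f (Fin.cons y z)))) ((Set.pi (Set.univ : Set (Fin m)) fun _ => Set.Icc (-S) S)) volume := iR.const_mul _
    rw [e, integral_sub iA iR', integral_const_mul]

/-- Positivity of the numerator of `g''` for the fibre marginal `g = −log ∫ e^{-f(y,·)}`: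
`(U − T) Z + R² > 0`, i.e. `g'' = ⟨f₀₀⟩ − Var_z ∂₀f > 0`, from the inductive hypothesis applied to
`∂₀f(y,·)` and the Schur positivity. [cite: BrascampLieb1976, Thm 4.2 / proof of Thm 4.1] -/
theorem step_Ng_pos {S : ℝ} (hS : 0 < S) (ih : (∀ (f h : (Fin m → ℝ) → ℝ), ContDiff ℝ 2 f → (∀ x, (coordHessian f x).PosDef) →
        ContDiff ℝ 1 h →
        (∫ x in (Set.pi (Set.univ : Set (Fin m)) fun _ => Set.Icc (-S) S), h x ^ 2 * Real.exp (-f x)) *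
            (∫ x in (Set.pi (Set.univ : Set (Fin m)) fun _ => Set.Icc (-S) S), Real.exp (-f x)) -
          (∫ x in (Set.pi (Set.univ : Set (Fin m)) fun _ => Set.Icc (-S) S), h x * Real.exp (-f x)) ^ 2 ≤
        (∫ x in (Set.pi (Set.univ : Set (Fin m)) fun _ => Set.Icc (-S) S),
            (coordGradient h x ⬝ᵥ ((coordHessian f x)⁻¹ *ᵥ coordGradient h x)) * Real.exp (-f x)) *
          (∫ x in (Set.pi (Set.univ : Set (Fin m)) fun _ => Set.Icc (-S) S), Real.exp (-f x)))) {f : (Fin (m + 1) → ℝ) → ℝ}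
    (hf : ContDiff ℝ 2 f) (hpd : ∀ x, (coordHessian f x).PosDef) (y : ℝ) :
    0 < ((∫ z in (Set.pi (Set.univ : Set (Fin m)) fun _ => Set.Icc (-S) S), coordHessian f (Fin.cons y z) 0 0 * Real.exp (-f (Fin.cons y z))) -
            (∫ z in (Set.pi (Set.univ : Set (Fin m)) fun _ => Set.Icc (-S) S), (fderiv ℝ f (Fin.cons y z) (Pi.single 0 1)) ^ 2 *
              Real.exp (-f (Fin.cons y z)))) *
          (∫ z in (Set.pi (Set.univ : Set (Fin m)) fun _ => Set.Icc (-S) S), Real.exp (-f (Fin.cons y z))) +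
        (∫ z in (Set.pi (Set.univ : Set (Fin m)) fun _ => Set.Icc (-S) S), fderiv ℝ f (Fin.cons y z) (Pi.single 0 1) *
          Real.exp (-f (Fin.cons y z))) ^ 2 := by
  have hEc : Continuous fun x => Real.exp (-f x) := continuous_expNeg hf.continuous
  have hf0 : ContDiff ℝ 1 (fun x => fderiv ℝ f x (Pi.single 0 1)) :=
    contDiff_one_fderiv_apply hf _
  have hfy : ContDiff ℝ 2 (fun z : Fin m → ℝ => f (Fin.cons y z)) := hf.comp (contDiff_cons_right y)
  have hpdy : ∀ z, (coordHessian (fun z : Fin m → ℝ => f (Fin.cons y z)) z).PosDef :=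
    posDef_coordHessian_comp_cons hf hpd y
  have hφ0 : ContDiff ℝ 1 (fun z : Fin m → ℝ => fderiv ℝ f (Fin.cons y z) (Pi.single 0 1)) :=
    hf0.comp (contDiff_cons_right y)
  have hZpos : 0 < ∫ z in (Set.pi (Set.univ : Set (Fin m)) fun _ => Set.Icc (-S) S), Real.exp (-f (Fin.cons y z)) :=
    setIntegral_cube_pos (hEc.comp (continuous_cons_right y)) (fun z => Real.exp_pos _) hS
  have hWU := step_W_lt_U hf hpd hS y
  have ih1 := ih (fun z : Fin m → ℝ => f (Fin.cons y z))
    (fun z : Fin m → ℝ => fderiv ℝ f (Fin.cons y z) (Pi.single 0 1)) hfy hpdy hφ0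
  beta_reduce at ih1
  have h2 := mul_lt_mul_of_pos_right hWU hZpos
  nlinarith [ih1, h2]

/-- **The fibre inequality of the inductive step.** Assuming the raw Brascamp–Lieb inequality on
`[-S,S]^m`, for `f ∈ C²(ℝ^{m+1})` with positive definite Hessian and `h ∈ C¹`, at every `y`:
`B Z − A² + ((P − C)Z + A R)² / ((U − T)Z + R²) ≤ Q Z`, where (integrals over the fibre cube
against `e^{-f(y,·)}`) `Z = ∫1`, `A = ∫h`, `B = ∫h²`, `P = ∫∂₀h`, `R = ∫∂₀f`, `C = ∫h ∂₀f`, `T = ∫(∂₀f)²`,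
`U = ∫f₀₀`, `Q = ∫∇hᵀf_xx⁻¹∇h`; i.e. `Var_z h + H'²/g'' ≤ ⟨∇hᵀf_xx⁻¹∇h⟩_z` with `H = ⟨h⟩_z`,
`g = −log Z` (Brascamp–Lieb's (4.9)–(4.10) combined, optimising over `t` in `φ_t = h − t∂₀f`).
[cite: BrascampLieb1976, proof of Thm 4.1] -/
theorem step_main_fibre {S : ℝ} (hS : 0 < S) (ih : (∀ (f h : (Fin m → ℝ) → ℝ), ContDiff ℝ 2 f → (∀ x, (coordHessian f x).PosDef) →
        ContDiff ℝ 1 h →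
        (∫ x in (Set.pi (Set.univ : Set (Fin m)) fun _ => Set.Icc (-S) S), h x ^ 2 * Real.exp (-f x)) *
            (∫ x in (Set.pi (Set.univ : Set (Fin m)) fun _ => Set.Icc (-S) S), Real.exp (-f x)) -
          (∫ x in (Set.pi (Set.univ : Set (Fin m)) fun _ => Set.Icc (-S) S), h x * Real.exp (-f x)) ^ 2 ≤
        (∫ x in (Set.pi (Set.univ : Set (Fin m)) fun _ => Set.Icc (-S) S),
            (coordGradient h x ⬝ᵥ ((coordHessian f x)⁻¹ *ᵥ coordGradient h x)) * Real.exp (-f x)) *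
          (∫ x in (Set.pi (Set.univ : Set (Fin m)) fun _ => Set.Icc (-S) S), Real.exp (-f x)))) {f h : (Fin (m + 1) → ℝ) → ℝ}
    (hf : ContDiff ℝ 2 f) (hpd : ∀ x, (coordHessian f x).PosDef) (hh : ContDiff ℝ 1 h) (y : ℝ) :
    (∫ z in (Set.pi (Set.univ : Set (Fin m)) fun _ => Set.Icc (-S) S), h (Fin.cons y z) ^ 2 * Real.exp (-f (Fin.cons y z))) *
          (∫ z in (Set.pi (Set.univ : Set (Fin m)) fun _ => Set.Icc (-S) S), Real.exp (-f (Fin.cons y z))) -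
        (∫ z in (Set.pi (Set.univ : Set (Fin m)) fun _ => Set.Icc (-S) S), h (Fin.cons y z) * Real.exp (-f (Fin.cons y z))) ^ 2 +
        (((∫ z in (Set.pi (Set.univ : Set (Fin m)) fun _ => Set.Icc (-S) S), fderiv ℝ h (Fin.cons y z) (Pi.single 0 1) * Real.exp (-f (Fin.cons y z))) -
            (∫ z in (Set.pi (Set.univ : Set (Fin m)) fun _ => Set.Icc (-S) S), h (Fin.cons y z) * fderiv ℝ f (Fin.cons y z) (Pi.single 0 1) *
              Real.exp (-f (Fin.cons y z)))) *
            (∫ z in (Set.pi (Set.univ : Set (Fin m)) fun _ => Set.Icc (-S) S), Real.exp (-f (Fin.cons y z))) +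
          (∫ z in (Set.pi (Set.univ : Set (Fin m)) fun _ => Set.Icc (-S) S), h (Fin.cons y z) * Real.exp (-f (Fin.cons y z))) *
            (∫ z in (Set.pi (Set.univ : Set (Fin m)) fun _ => Set.Icc (-S) S), fderiv ℝ f (Fin.cons y z) (Pi.single 0 1) *
              Real.exp (-f (Fin.cons y z)))) ^ 2 /
        (((∫ z in (Set.pi (Set.univ : Set (Fin m)) fun _ => Set.Icc (-S) S), coordHessian f (Fin.cons y z) 0 0 * Real.exp (-f (Fin.cons y z))) -
            (∫ z in (Set.pi (Set.univ : Set (Fin m)) fun _ => Set.Icc (-S) S), (fderiv ℝ f (Fin.cons y z) (Pi.single 0 1)) ^ 2 *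
              Real.exp (-f (Fin.cons y z)))) *
            (∫ z in (Set.pi (Set.univ : Set (Fin m)) fun _ => Set.Icc (-S) S), Real.exp (-f (Fin.cons y z))) +
          (∫ z in (Set.pi (Set.univ : Set (Fin m)) fun _ => Set.Icc (-S) S), fderiv ℝ f (Fin.cons y z) (Pi.single 0 1) *
            Real.exp (-f (Fin.cons y z))) ^ 2) ≤
      (∫ z in (Set.pi (Set.univ : Set (Fin m)) fun _ => Set.Icc (-S) S), (coordGradient h (Fin.cons y z) ⬝ᵥ ((coordHessian f (Fin.cons y z))⁻¹ *ᵥ coordGradient h (Fin.cons y z))) * Real.exp (-f (Fin.cons y z))) *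
        (∫ z in (Set.pi (Set.univ : Set (Fin m)) fun _ => Set.Icc (-S) S), Real.exp (-f (Fin.cons y z))) := by
  -- fibre data
  have hEc : Continuous fun x => Real.exp (-f x) := continuous_expNeg hf.continuous
  have hf0 : ContDiff ℝ 1 (fun x => fderiv ℝ f x (Pi.single 0 1)) :=
    contDiff_one_fderiv_apply hf _
  have hfy : ContDiff ℝ 2 (fun z : Fin m → ℝ => f (Fin.cons y z)) := hf.comp (contDiff_cons_right y)
  have hpdy : ∀ z, (coordHessian (fun z : Fin m → ℝ => f (Fin.cons y z)) z).PosDef :=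
    posDef_coordHessian_comp_cons hf hpd y
  have hφ0 : ContDiff ℝ 1 (fun z : Fin m → ℝ => fderiv ℝ f (Fin.cons y z) (Pi.single 0 1)) :=
    hf0.comp (contDiff_cons_right y)
  have hZpos : 0 < ∫ z in (Set.pi (Set.univ : Set (Fin m)) fun _ => Set.Icc (-S) S), Real.exp (-f (Fin.cons y z)) :=
    setIntegral_cube_pos (hEc.comp (continuous_cons_right y)) (fun z => Real.exp_pos _) hS
  -- names for the fibre integrals
  obtain ⟨Z, hZ⟩ : ∃ Z : ℝ, Z = ∫ z in (Set.pi (Set.univ : Set (Fin m)) fun _ => Set.Icc (-S) S), Real.exp (-f (Fin.cons y z)) := ⟨_, rfl⟩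
  obtain ⟨A, hA⟩ : ∃ A : ℝ, A = ∫ z in (Set.pi (Set.univ : Set (Fin m)) fun _ => Set.Icc (-S) S), h (Fin.cons y z) * Real.exp (-f (Fin.cons y z)) :=
    ⟨_, rfl⟩
  obtain ⟨B, hB⟩ : ∃ B : ℝ, B = ∫ z in (Set.pi (Set.univ : Set (Fin m)) fun _ => Set.Icc (-S) S), h (Fin.cons y z) ^ 2 * Real.exp (-f (Fin.cons y z)) :=
    ⟨_, rfl⟩
  obtain ⟨P, hP⟩ : ∃ P : ℝ, P = ∫ z in (Set.pi (Set.univ : Set (Fin m)) fun _ => Set.Icc (-S) S), fderiv ℝ h (Fin.cons y z) (Pi.single 0 1) *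
      Real.exp (-f (Fin.cons y z)) := ⟨_, rfl⟩
  obtain ⟨R, hR⟩ : ∃ R : ℝ, R = ∫ z in (Set.pi (Set.univ : Set (Fin m)) fun _ => Set.Icc (-S) S), fderiv ℝ f (Fin.cons y z) (Pi.single 0 1) *
      Real.exp (-f (Fin.cons y z)) := ⟨_, rfl⟩
  obtain ⟨C, hC⟩ : ∃ C : ℝ, C = ∫ z in (Set.pi (Set.univ : Set (Fin m)) fun _ => Set.Icc (-S) S), h (Fin.cons y z) *
      fderiv ℝ f (Fin.cons y z) (Pi.single 0 1) * Real.exp (-f (Fin.cons y z)) := ⟨_, rfl⟩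
  obtain ⟨T, hT⟩ : ∃ T : ℝ, T = ∫ z in (Set.pi (Set.univ : Set (Fin m)) fun _ => Set.Icc (-S) S), (fderiv ℝ f (Fin.cons y z) (Pi.single 0 1)) ^ 2 *
      Real.exp (-f (Fin.cons y z)) := ⟨_, rfl⟩
  obtain ⟨U, hU⟩ : ∃ U : ℝ, U = ∫ z in (Set.pi (Set.univ : Set (Fin m)) fun _ => Set.Icc (-S) S), coordHessian f (Fin.cons y z) 0 0 *
      Real.exp (-f (Fin.cons y z)) := ⟨_, rfl⟩
  obtain ⟨Q, hQ⟩ : ∃ Q : ℝ, Q = ∫ z in (Set.pi (Set.univ : Set (Fin m)) fun _ => Set.Icc (-S) S), (coordGradient h (Fin.cons y z) ⬝ᵥ ((coordHessian f (Fin.cons y z))⁻¹ *ᵥ coordGradient h (Fin.cons y z))) *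
      Real.exp (-f (Fin.cons y z)) := ⟨_, rfl⟩
  rw [← hZ, ← hA, ← hB, ← hP, ← hR, ← hC, ← hT, ← hU, ← hQ]
  rw [← hZ] at hZpos
  -- `(U - T) Z + R² > 0`
  have hNg : 0 < (U - T) * Z + R ^ 2 := by
    have := step_Ng_pos hS ih hf hpd y
    rwa [← hZ, ← hT, ← hR, ← hU] at this
  -- the optimal `t`
  set t : ℝ := ((P - C) * Z + A * R) / ((U - T) * Z + R ^ 2) with ht
  have hφt : ContDiff ℝ 1 (fun z : Fin m → ℝ => h (Fin.cons y z) -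
      t * fderiv ℝ f (Fin.cons y z) (Pi.single 0 1)) :=
    (hh.comp (contDiff_cons_right y)).sub (contDiff_const.mul hφ0)
  obtain ⟨Qt, hQt⟩ : ∃ Qt : ℝ, Qt = ∫ z in (Set.pi (Set.univ : Set (Fin m)) fun _ => Set.Icc (-S) S), (coordGradient (fun z : Fin m → ℝ => h (Fin.cons y z) - t * fderiv ℝ f (Fin.cons y z) (Pi.single 0 1)) z ⬝ᵥ ((coordHessian (fun z : Fin m → ℝ => f (Fin.cons y z)) z)⁻¹ *ᵥ coordGradient (fun z : Fin m → ℝ => h (Fin.cons y z) - t * fderiv ℝ f (Fin.cons y z) (Pi.single 0 1)) z)) *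
      Real.exp (-f (Fin.cons y z)) := ⟨_, rfl⟩
  have hint := step_integrated_bound hf hpd hh S y t
  rw [← hP, ← hU, ← hQt, ← hQ] at hint
  have ih2 := ih (fun z : Fin m → ℝ => f (Fin.cons y z))
    (fun z : Fin m → ℝ => h (Fin.cons y z) - t * fderiv ℝ f (Fin.cons y z) (Pi.single 0 1))
    hfy hpdy hφt
  beta_reduce at ih2
  obtain ⟨eB, eA⟩ := step_expand hf hh S y t
  rw [eB, eA, ← hZ, ← hB, ← hC, ← hT, ← hA, ← hR, ← hQt] at ih2
  have hmul := mul_le_mul_of_nonneg_right hint hZpos.le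
  have e2 : 2 * t * ((P - C) * Z + A * R) - t ^ 2 * ((U - T) * Z + R ^ 2) =
      ((P - C) * Z + A * R) ^ 2 / ((U - T) * Z + R ^ 2) := by
    rw [ht]
    field_simp
    ring
  calc B * Z - A ^ 2 + ((P - C) * Z + A * R) ^ 2 / ((U - T) * Z + R ^ 2)
      = B * Z - A ^ 2 + (2 * t * ((P - C) * Z + A * R) - t ^ 2 * ((U - T) * Z + R ^ 2)) := by
        rw [e2]
    _ = (2 * t * P - t ^ 2 * U) * Z + ((B - 2 * t * C + t ^ 2 * T) * Z - (A - t * R) ^ 2) := by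
        ring
    _ ≤ (2 * t * P - t ^ 2 * U) * Z + Qt * Z := by linarith [ih2]
    _ = (2 * t * P - t ^ 2 * U + Qt) * Z := by ring
    _ ≤ Q * Z := hmul

/-- **Inductive step of the cube Brascamp–Lieb inequality**: the raw inequality on `[-S,S]^m`
(for all `C²` strictly convex weights and all `C¹` observables) implies it on `[-S,S]^{m+1}`.
Fibre by fibre one has `Var_z h + H'²/g'' ≤ ⟨∇hᵀf_xx⁻¹∇h⟩_z` (`step_main_fibre`); integrating in
`y` against the marginal `Z = e^{-g}`, the one-dimensional inequality on `[-S,S]`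
(`brascampLieb_interval_Icc`) bounds `Var_y H ≤ ⟨H'²/g''⟩_y`, and
`Var h = ⟨Var_z h⟩_y + Var_y H`. [cite: BrascampLieb1976, proof of Thm 4.1] -/
theorem bl_cube_succ {S : ℝ} (hS : 0 < S) (ih : (∀ (f h : (Fin m → ℝ) → ℝ), ContDiff ℝ 2 f → (∀ x, (coordHessian f x).PosDef) →
        ContDiff ℝ 1 h →
        (∫ x in (Set.pi (Set.univ : Set (Fin m)) fun _ => Set.Icc (-S) S), h x ^ 2 * Real.exp (-f x)) *
            (∫ x in (Set.pi (Set.univ : Set (Fin m)) fun _ => Set.Icc (-S) S), Real.exp (-f x)) -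
          (∫ x in (Set.pi (Set.univ : Set (Fin m)) fun _ => Set.Icc (-S) S), h x * Real.exp (-f x)) ^ 2 ≤
        (∫ x in (Set.pi (Set.univ : Set (Fin m)) fun _ => Set.Icc (-S) S),
            (coordGradient h x ⬝ᵥ ((coordHessian f x)⁻¹ *ᵥ coordGradient h x)) * Real.exp (-f x)) *
          (∫ x in (Set.pi (Set.univ : Set (Fin m)) fun _ => Set.Icc (-S) S), Real.exp (-f x)))) : (∀ (f h : (Fin (m + 1) → ℝ) → ℝ), ContDiff ℝ 2 f → (∀ x, (coordHessian f x).PosDef) →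
        ContDiff ℝ 1 h →
        (∫ x in (Set.pi (Set.univ : Set (Fin (m + 1))) fun _ => Set.Icc (-S) S), h x ^ 2 * Real.exp (-f x)) *
            (∫ x in (Set.pi (Set.univ : Set (Fin (m + 1))) fun _ => Set.Icc (-S) S), Real.exp (-f x)) -
          (∫ x in (Set.pi (Set.univ : Set (Fin (m + 1))) fun _ => Set.Icc (-S) S), h x * Real.exp (-f x)) ^ 2 ≤
        (∫ x in (Set.pi (Set.univ : Set (Fin (m + 1))) fun _ => Set.Icc (-S) S),
            (coordGradient h x ⬝ᵥ ((coordHessian f x)⁻¹ *ᵥ coordGradient h x)) * Real.exp (-f x)) *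
          (∫ x in (Set.pi (Set.univ : Set (Fin (m + 1))) fun _ => Set.Icc (-S) S), Real.exp (-f x))) := by
  intro f h hf hpd hh
  -- continuity of the integrands
  have hEc : Continuous fun x => Real.exp (-f x) := continuous_expNeg hf.continuous
  have hhc : Continuous h := hh.continuous
  have hf0c : Continuous fun x => fderiv ℝ f x (Pi.single 0 1) :=
    continuous_fderiv_apply (hf.of_le one_le_two) _
  have hh0c : Continuous fun x => fderiv ℝ h x (Pi.single 0 1) := continuous_fderiv_apply hh _
  have hf00c : Continuous fun x => coordHessian f x 0 0 :=
    (continuous_coordHessian hf).matrix_elem 0 0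
  have hqc : Continuous fun x => (coordGradient h x ⬝ᵥ ((coordHessian f x)⁻¹ *ᵥ coordGradient h x)) := continuous_blQuad hf hpd hh
  -- the fibre integrals as functions of `y`
  obtain ⟨Z, hZ⟩ : ∃ Z : ℝ → ℝ, Z = fun y => ∫ z in (Set.pi (Set.univ : Set (Fin m)) fun _ => Set.Icc (-S) S), Real.exp (-f (Fin.cons y z)) :=
    ⟨_, rfl⟩
  obtain ⟨A, hA⟩ : ∃ A : ℝ → ℝ, A = fun y => ∫ z in (Set.pi (Set.univ : Set (Fin m)) fun _ => Set.Icc (-S) S), h (Fin.cons y z) *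
      Real.exp (-f (Fin.cons y z)) := ⟨_, rfl⟩
  obtain ⟨B, hB⟩ : ∃ B : ℝ → ℝ, B = fun y => ∫ z in (Set.pi (Set.univ : Set (Fin m)) fun _ => Set.Icc (-S) S), h (Fin.cons y z) ^ 2 *
      Real.exp (-f (Fin.cons y z)) := ⟨_, rfl⟩
  obtain ⟨P, hP⟩ : ∃ P : ℝ → ℝ, P = fun y => ∫ z in (Set.pi (Set.univ : Set (Fin m)) fun _ => Set.Icc (-S) S),
      fderiv ℝ h (Fin.cons y z) (Pi.single 0 1) * Real.exp (-f (Fin.cons y z)) := ⟨_, rfl⟩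
  obtain ⟨R, hR⟩ : ∃ R : ℝ → ℝ, R = fun y => ∫ z in (Set.pi (Set.univ : Set (Fin m)) fun _ => Set.Icc (-S) S),
      fderiv ℝ f (Fin.cons y z) (Pi.single 0 1) * Real.exp (-f (Fin.cons y z)) := ⟨_, rfl⟩
  obtain ⟨C, hC⟩ : ∃ C : ℝ → ℝ, C = fun y => ∫ z in (Set.pi (Set.univ : Set (Fin m)) fun _ => Set.Icc (-S) S), h (Fin.cons y z) *
      fderiv ℝ f (Fin.cons y z) (Pi.single 0 1) * Real.exp (-f (Fin.cons y z)) := ⟨_, rfl⟩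
  obtain ⟨T, hT⟩ : ∃ T : ℝ → ℝ, T = fun y => ∫ z in (Set.pi (Set.univ : Set (Fin m)) fun _ => Set.Icc (-S) S),
      (fderiv ℝ f (Fin.cons y z) (Pi.single 0 1)) ^ 2 * Real.exp (-f (Fin.cons y z)) := ⟨_, rfl⟩
  obtain ⟨U, hU⟩ : ∃ U : ℝ → ℝ, U = fun y => ∫ z in (Set.pi (Set.univ : Set (Fin m)) fun _ => Set.Icc (-S) S),
      coordHessian f (Fin.cons y z) 0 0 * Real.exp (-f (Fin.cons y z)) := ⟨_, rfl⟩
  obtain ⟨Q, hQ⟩ : ∃ Q : ℝ → ℝ, Q = fun y => ∫ z in (Set.pi (Set.univ : Set (Fin m)) fun _ => Set.Icc (-S) S), (coordGradient h (Fin.cons y z) ⬝ᵥ ((coordHessian f (Fin.cons y z))⁻¹ *ᵥ coordGradient h (Fin.cons y z))) *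
      Real.exp (-f (Fin.cons y z)) := ⟨_, rfl⟩
  -- continuity in `y`
  have hZc : Continuous Z := by rw [hZ]; exact continuous_fibreIntegral S hEc
  have hAc : Continuous A := by
    rw [hA]; exact continuous_fibreIntegral S (ψ := fun x => h x * Real.exp (-f x)) (hhc.mul hEc)
  have hBc : Continuous B := by
    rw [hB]
    exact continuous_fibreIntegral S (ψ := fun x => h x ^ 2 * Real.exp (-f x)) ((hhc.pow 2).mul hEc)
  have hPc : Continuous P := by
    rw [hP]
    exact continuous_fibreIntegral S
      (ψ := fun x => fderiv ℝ h x (Pi.single 0 1) * Real.exp (-f x)) (hh0c.mul hEc)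
  have hRc : Continuous R := by
    rw [hR]
    exact continuous_fibreIntegral S
      (ψ := fun x => fderiv ℝ f x (Pi.single 0 1) * Real.exp (-f x)) (hf0c.mul hEc)
  have hCc : Continuous C := by
    rw [hC]
    exact continuous_fibreIntegral S
      (ψ := fun x => h x * fderiv ℝ f x (Pi.single 0 1) * Real.exp (-f x)) ((hhc.mul hf0c).mul hEc)
  have hTc : Continuous T := by
    rw [hT]
    exact continuous_fibreIntegral S
      (ψ := fun x => (fderiv ℝ f x (Pi.single 0 1)) ^ 2 * Real.exp (-f x)) ((hf0c.pow 2).mul hEc)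
  have hUc : Continuous U := by
    rw [hU]
    exact continuous_fibreIntegral S
      (ψ := fun x => coordHessian f x 0 0 * Real.exp (-f x)) (hf00c.mul hEc)
  have hQc : Continuous Q := by
    rw [hQ]
    exact continuous_fibreIntegral S (ψ := fun x => (coordGradient h x ⬝ᵥ ((coordHessian f x)⁻¹ *ᵥ coordGradient h x)) * Real.exp (-f x)) (hqc.mul hEc)
  -- positivity of `Z` and of the numerator of `g''`
  have hZpos : ∀ y, 0 < Z y := fun y => by
    rw [hZ]
    exact setIntegral_cube_pos (hEc.comp (continuous_cons_right y)) (fun z => Real.exp_pos _) hS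
  have hNg : ∀ y, 0 < (U y - T y) * Z y + R y ^ 2 := fun y => by
    have := step_Ng_pos hS ih hf hpd y
    simp only [hU, hT, hZ, hR]
    exact this
  -- derivatives in `y`
  have hZd : ∀ y, HasDerivAt Z (-R y) y := fun y => by
    have := hasDerivAt_fibreIntegral S (ψ := fun x => Real.exp (-f x))
      (ψ' := fun x => -(fderiv ℝ f x (Pi.single 0 1) * Real.exp (-f x))) hEc (hf0c.mul hEc).neg
      (fun y z => hasDerivAt_expNeg_cons hf y z) y
    rw [integral_neg] at this
    rw [hZ, hR]
    exact this
  have hRd : ∀ y, HasDerivAt R (U y - T y) y := fun y => by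
    have hder : ∀ (y : ℝ) (z : Fin m → ℝ), HasDerivAt
        (fun y : ℝ => fderiv ℝ f (Fin.cons y z) (Pi.single 0 1) * Real.exp (-f (Fin.cons y z)))
        (coordHessian f (Fin.cons y z) 0 0 * Real.exp (-f (Fin.cons y z)) -
          (fderiv ℝ f (Fin.cons y z) (Pi.single 0 1)) ^ 2 * Real.exp (-f (Fin.cons y z))) y :=
      fun y z => ((hasDerivAt_fderiv0_cons hf y z).mul (hasDerivAt_expNeg_cons hf y z)).congr_deriv
        (by ring)
    have := hasDerivAt_fibreIntegral S
      (ψ := fun x => fderiv ℝ f x (Pi.single 0 1) * Real.exp (-f x))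
      (ψ' := fun x => coordHessian f x 0 0 * Real.exp (-f x) -
        (fderiv ℝ f x (Pi.single 0 1)) ^ 2 * Real.exp (-f x))
      (hf0c.mul hEc) ((hf00c.mul hEc).sub ((hf0c.pow 2).mul hEc)) hder y
    have i1 : IntegrableOn (fun z : Fin m → ℝ => coordHessian f (Fin.cons y z) 0 0 *
        Real.exp (-f (Fin.cons y z))) ((Set.pi (Set.univ : Set (Fin m)) fun _ => Set.Icc (-S) S)) volume :=
      integrableOn_fibre (ψ := fun x => coordHessian f x 0 0 * Real.exp (-f x)) (hf00c.mul hEc) S y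
    have i2 : IntegrableOn (fun z : Fin m → ℝ => (fderiv ℝ f (Fin.cons y z) (Pi.single 0 1)) ^ 2 *
        Real.exp (-f (Fin.cons y z))) ((Set.pi (Set.univ : Set (Fin m)) fun _ => Set.Icc (-S) S)) volume :=
      integrableOn_fibre (ψ := fun x => (fderiv ℝ f x (Pi.single 0 1)) ^ 2 * Real.exp (-f x))
        ((hf0c.pow 2).mul hEc) S y
    rw [integral_sub i1 i2] at this
    rw [hR, hU, hT]
    exact this
  have hAd : ∀ y, HasDerivAt A (P y - C y) y := fun y => by
    have hder : ∀ (y : ℝ) (z : Fin m → ℝ), HasDerivAt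
        (fun y : ℝ => h (Fin.cons y z) * Real.exp (-f (Fin.cons y z)))
        (fderiv ℝ h (Fin.cons y z) (Pi.single 0 1) * Real.exp (-f (Fin.cons y z)) -
          h (Fin.cons y z) * fderiv ℝ f (Fin.cons y z) (Pi.single 0 1) *
            Real.exp (-f (Fin.cons y z))) y :=
      fun y z => ((hasDerivAt_cons_of_contDiff hh y z).mul (hasDerivAt_expNeg_cons hf y z)).congr_deriv
        (by ring)
    have := hasDerivAt_fibreIntegral S (ψ := fun x => h x * Real.exp (-f x))
      (ψ' := fun x => fderiv ℝ h x (Pi.single 0 1) * Real.exp (-f x) -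
        h x * fderiv ℝ f x (Pi.single 0 1) * Real.exp (-f x))
      (hhc.mul hEc) ((hh0c.mul hEc).sub ((hhc.mul hf0c).mul hEc)) hder y
    have i1 : IntegrableOn (fun z : Fin m → ℝ => fderiv ℝ h (Fin.cons y z) (Pi.single 0 1) *
        Real.exp (-f (Fin.cons y z))) ((Set.pi (Set.univ : Set (Fin m)) fun _ => Set.Icc (-S) S)) volume :=
      integrableOn_fibre (ψ := fun x => fderiv ℝ h x (Pi.single 0 1) * Real.exp (-f x))
        (hh0c.mul hEc) S y
    have i2 : IntegrableOn (fun z : Fin m → ℝ => h (Fin.cons y z) *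
        fderiv ℝ f (Fin.cons y z) (Pi.single 0 1) * Real.exp (-f (Fin.cons y z))) ((Set.pi (Set.univ : Set (Fin m)) fun _ => Set.Icc (-S) S)) volume :=
      integrableOn_fibre (ψ := fun x => h x * fderiv ℝ f x (Pi.single 0 1) * Real.exp (-f x))
        ((hhc.mul hf0c).mul hEc) S y
    rw [integral_sub i1 i2] at this
    rw [hA, hP, hC]
    exact this
  -- the marginal data `g = -log Z`, `g' = R/Z`, `g''`, `H = A/Z`, `H'`
  have hgd : ∀ y, HasDerivAt (fun y => -Real.log (Z y)) (R y / Z y) y := fun y => by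
    have := ((hZd y).log (hZpos y).ne').neg
    exact this.congr_deriv (by field_simp)
  have hg₁d : ∀ y, HasDerivAt (fun y => R y / Z y) (((U y - T y) * Z y + R y ^ 2) / Z y ^ 2) y :=
    fun y => ((hRd y).div (hZd y) (hZpos y).ne').congr_deriv (by ring)
  have hHd : ∀ y, HasDerivAt (fun y => A y / Z y) (((P y - C y) * Z y + A y * R y) / Z y ^ 2) y :=
    fun y => ((hAd y).div (hZd y) (hZpos y).ne').congr_deriv (by ring)
  have hZne : ∀ y, Z y ^ 2 ≠ 0 := fun y => pow_ne_zero 2 (hZpos y).ne'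
  have hg₂c : Continuous fun y => ((U y - T y) * Z y + R y ^ 2) / Z y ^ 2 :=
    ((((hUc.sub hTc).mul hZc).add (hRc.pow 2)).div (hZc.pow 2) hZne)
  have hH₁c : Continuous fun y => ((P y - C y) * Z y + A y * R y) / Z y ^ 2 :=
    ((((hPc.sub hCc).mul hZc).add (hAc.mul hRc)).div (hZc.pow 2) hZne)
  have hg₂pos : ∀ y, 0 < ((U y - T y) * Z y + R y ^ 2) / Z y ^ 2 := fun y =>
    div_pos (hNg y) (pow_pos (hZpos y) 2)
  -- the one-dimensional inequality for `(g, H)` on `[-S, S]`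
  obtain ⟨c, hc⟩ := brascampLieb_interval_Icc (α := -S) (β := S) (by linarith)
    (g := fun y => -Real.log (Z y)) (g₁ := fun y => R y / Z y)
    (g₂ := fun y => ((U y - T y) * Z y + R y ^ 2) / Z y ^ 2) (H := fun y => A y / Z y)
    (H₁ := fun y => ((P y - C y) * Z y + A y * R y) / Z y ^ 2)
    (fun y _ => hgd y) (fun y _ => hg₁d y) (fun y _ => hHd y) hg₂c.continuousOn hH₁c.continuousOn
    (fun y _ => hg₂pos y)
  have hexp : ∀ y, Real.exp (-(-Real.log (Z y))) = Z y := fun y => by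
    rw [neg_neg, Real.exp_log (hZpos y)]
  simp only [hexp] at hc
  -- the fibre inequality, divided by `Z`
  have hy : ∀ y, B y - (A y / Z y) ^ 2 * Z y +
      (((P y - C y) * Z y + A y * R y) / Z y ^ 2) ^ 2 / (((U y - T y) * Z y + R y ^ 2) / Z y ^ 2) *
        Z y ≤ Q y := fun y => by
    have hm := step_main_fibre hS ih hf hpd hh y
    have hZy := hZpos y
    have hNgy := hNg y
    have e1 : B y - (A y / Z y) ^ 2 * Z y +
        (((P y - C y) * Z y + A y * R y) / Z y ^ 2) ^ 2 / (((U y - T y) * Z y + R y ^ 2) / Z y ^ 2) *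
          Z y =
        (B y * Z y - A y ^ 2 + ((P y - C y) * Z y + A y * R y) ^ 2 / ((U y - T y) * Z y + R y ^ 2)) /
          Z y := by
      field_simp
    rw [e1, div_le_iff₀ hZy]
    simp only [hB, hZ, hA, hP, hC, hR, hU, hT, hQ]
    exact hm
  -- integrate over `y ∈ [-S, S]`
  have iI : ∀ {F : ℝ → ℝ}, Continuous F → IntegrableOn F (Set.Icc (-S) S) volume :=
    fun hF => hF.integrableOn_Icc
  have hH2c : Continuous fun y => (A y / Z y) ^ 2 * Z y :=
    ((hAc.div hZc fun y => (hZpos y).ne').pow 2).mul hZc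
  have hK1c : Continuous fun y =>
      (((P y - C y) * Z y + A y * R y) / Z y ^ 2) ^ 2 / (((U y - T y) * Z y + R y ^ 2) / Z y ^ 2) *
        Z y :=
    ((hH₁c.pow 2).div hg₂c fun y => (hg₂pos y).ne').mul hZc
  have hint1 : (∫ y in Set.Icc (-S) S, B y - (A y / Z y) ^ 2 * Z y +
      (((P y - C y) * Z y + A y * R y) / Z y ^ 2) ^ 2 / (((U y - T y) * Z y + R y ^ 2) / Z y ^ 2) *
        Z y) ≤ ∫ y in Set.Icc (-S) S, Q y :=
    setIntegral_mono (iI ((hBc.sub hH2c).add hK1c)) (iI hQc) hy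
  have hBH : IntegrableOn (fun y => B y - (A y / Z y) ^ 2 * Z y) (Set.Icc (-S) S) volume :=
    iI (hBc.sub hH2c)
  rw [integral_add hBH (iI hK1c), integral_sub (iI hBc) (iI hH2c)] at hint1
  -- expand `∫ (H - c)² Z`
  have hHZc : Continuous fun y => (A y / Z y - c) ^ 2 * Z y :=
    (((hAc.div hZc fun y => (hZpos y).ne').sub continuous_const).pow 2).mul hZc
  have hexpand : ∫ y in Set.Icc (-S) S, (A y / Z y - c) ^ 2 * Z y =
      (∫ y in Set.Icc (-S) S, (A y / Z y) ^ 2 * Z y) - 2 * c * (∫ y in Set.Icc (-S) S, A y) +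
        c ^ 2 * (∫ y in Set.Icc (-S) S, Z y) := by
    have e : (fun y => (A y / Z y - c) ^ 2 * Z y) =
        fun y => (A y / Z y) ^ 2 * Z y - 2 * c * A y + c ^ 2 * Z y := by
      funext y
      have hZy := (hZpos y).ne'
      field_simp
      ring
    have i2 : IntegrableOn (fun y => 2 * c * A y) (Set.Icc (-S) S) volume := iI (continuous_const.mul hAc)
    have i3 : IntegrableOn (fun y => c ^ 2 * Z y) (Set.Icc (-S) S) volume := iI (continuous_const.mul hZc)
    have i12 : IntegrableOn (fun y => (A y / Z y) ^ 2 * Z y - 2 * c * A y) (Set.Icc (-S) S) volume :=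
      (iI hH2c).sub i2
    rw [e, integral_add i12 i3, integral_sub (iI hH2c) i2, integral_const_mul, integral_const_mul]
  -- Fubini: the cube integrals are the `y`-integrals of the fibre integrals
  have eZ : ∫ x in (Set.pi (Set.univ : Set (Fin (m + 1))) fun _ => Set.Icc (-S) S), Real.exp (-f x) = ∫ y in Set.Icc (-S) S, Z y := by
    rw [setIntegral_cube_succ S hEc, hZ]
  have eA : ∫ x in (Set.pi (Set.univ : Set (Fin (m + 1))) fun _ => Set.Icc (-S) S), h x * Real.exp (-f x) = ∫ y in Set.Icc (-S) S, A y := by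
    rw [setIntegral_cube_succ S (φ := fun x => h x * Real.exp (-f x)) (hhc.mul hEc), hA]
  have eB : ∫ x in (Set.pi (Set.univ : Set (Fin (m + 1))) fun _ => Set.Icc (-S) S), h x ^ 2 * Real.exp (-f x) = ∫ y in Set.Icc (-S) S, B y := by
    rw [setIntegral_cube_succ S (φ := fun x => h x ^ 2 * Real.exp (-f x)) ((hhc.pow 2).mul hEc), hB]
  have eQ : ∫ x in (Set.pi (Set.univ : Set (Fin (m + 1))) fun _ => Set.Icc (-S) S), (coordGradient h x ⬝ᵥ ((coordHessian f x)⁻¹ *ᵥ coordGradient h x)) * Real.exp (-f x) = ∫ y in Set.Icc (-S) S, Q y := by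
    rw [setIntegral_cube_succ S (φ := fun x => (coordGradient h x ⬝ᵥ ((coordHessian f x)⁻¹ *ᵥ coordGradient h x)) * Real.exp (-f x)) (hqc.mul hEc), hQ]
  rw [eZ, eA, eB, eQ]
  -- positivity of the total mass
  have hZtot : 0 < ∫ y in Set.Icc (-S) S, Z y := by
    rw [setIntegral_pos_iff_support_of_nonneg_ae (Eventually.of_forall fun y => (hZpos y).le)
      (iI hZc)]
    have : support Z = univ := by
      ext y; simp [(hZpos y).ne']
    rw [this, univ_inter, Real.volume_Icc]
    simp only [ENNReal.ofReal_pos]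
    linarith
  -- final algebra
  set IZ := ∫ y in Set.Icc (-S) S, Z y with hIZ
  set IA := ∫ y in Set.Icc (-S) S, A y with hIA
  set IB := ∫ y in Set.Icc (-S) S, B y with hIB
  set IQ := ∫ y in Set.Icc (-S) S, Q y with hIQ
  have h1 : IB - 2 * c * IA + c ^ 2 * IZ ≤ IQ := by linarith [hint1, hc, hexpand]
  nlinarith [sq_nonneg (IA - c * IZ), mul_le_mul_of_nonneg_right h1 hZtot.le]

/-- **Base case**: on `ℝ⁰` (a point) both sides of the raw inequality vanish. [folklore] -/
theorem bl_cube_zero (S : ℝ) : (∀ (f h : (Fin (0) → ℝ) → ℝ), ContDiff ℝ 2 f → (∀ x, (coordHessian f x).PosDef) →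
        ContDiff ℝ 1 h →
        (∫ x in (Set.pi (Set.univ : Set (Fin (0))) fun _ => Set.Icc (-S) S), h x ^ 2 * Real.exp (-f x)) *
            (∫ x in (Set.pi (Set.univ : Set (Fin (0))) fun _ => Set.Icc (-S) S), Real.exp (-f x)) -
          (∫ x in (Set.pi (Set.univ : Set (Fin (0))) fun _ => Set.Icc (-S) S), h x * Real.exp (-f x)) ^ 2 ≤
        (∫ x in (Set.pi (Set.univ : Set (Fin (0))) fun _ => Set.Icc (-S) S),
            (coordGradient h x ⬝ᵥ ((coordHessian f x)⁻¹ *ᵥ coordGradient h x)) * Real.exp (-f x)) *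
          (∫ x in (Set.pi (Set.univ : Set (Fin (0))) fun _ => Set.Icc (-S) S), Real.exp (-f x))) := by
  intro f h _ _ _
  have hK : ((Set.pi (Set.univ : Set (Fin (0))) fun _ => Set.Icc (-S) S)) = Set.univ := by
    ext x; simp
  have hvol : (volume : Measure (Fin 0 → ℝ)) = Measure.dirac (fun _ => 0) := by
    rw [volume_pi, Measure.pi_of_empty _ (fun _ => 0)]
  simp only [hK, Measure.restrict_univ, hvol, integral_dirac]
  have hq : coordGradient h (fun _ => 0) ⬝ᵥ ((coordHessian f (fun _ => 0))⁻¹ *ᵥ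
      coordGradient h (fun _ => 0)) = 0 := by
    simp [dotProduct]
  rw [hq]
  nlinarith

/-- **The raw Brascamp–Lieb inequality on cubes**: for `S > 0`, `f ∈ C²(ℝⁿ)` with positive
definite Hessian everywhere and `h ∈ C¹(ℝⁿ)`,
`(∫_K h² e^{-f})(∫_K e^{-f}) − (∫_K h e^{-f})² ≤ (∫_K ∇hᵀ f_xx⁻¹ ∇h e^{-f})(∫_K e^{-f})`,
`K = [-S,S]ⁿ`; i.e. `Var_{μ_K} h ≤ E_{μ_K}[∇hᵀ f_xx⁻¹ ∇h]` for `μ_K ∝ e^{-f} 1_K`. Proved by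
induction on `n` (`bl_cube_zero`, `bl_cube_succ`). [cite: BrascampLieb1976, Thm 4.1 / eq. (4.11)] -/
theorem bl_cube {S : ℝ} (hS : 0 < S) : ∀ n : ℕ, (∀ (f h : (Fin n → ℝ) → ℝ), ContDiff ℝ 2 f → (∀ x, (coordHessian f x).PosDef) →
        ContDiff ℝ 1 h →
        (∫ x in (Set.pi (Set.univ : Set (Fin n)) fun _ => Set.Icc (-S) S), h x ^ 2 * Real.exp (-f x)) *
            (∫ x in (Set.pi (Set.univ : Set (Fin n)) fun _ => Set.Icc (-S) S), Real.exp (-f x)) -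
          (∫ x in (Set.pi (Set.univ : Set (Fin n)) fun _ => Set.Icc (-S) S), h x * Real.exp (-f x)) ^ 2 ≤
        (∫ x in (Set.pi (Set.univ : Set (Fin n)) fun _ => Set.Icc (-S) S),
            (coordGradient h x ⬝ᵥ ((coordHessian f x)⁻¹ *ᵥ coordGradient h x)) * Real.exp (-f x)) *
          (∫ x in (Set.pi (Set.univ : Set (Fin n)) fun _ => Set.Icc (-S) S), Real.exp (-f x)))
  | 0 => bl_cube_zero S
  | n + 1 => bl_cube_succ hS (bl_cube hS n)

end Literature.Probability.Distributions
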